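import Literature.MathematicalPhysics.QuantumFieldTheory.Balaban1983to89.B9Eq3126ConjugatedQG1QInv
import Literature.MathematicalPhysics.QuantumFieldTheory.Balaban1983to89.B9Eq349BondPointDecayFromCircle
import Literature.MathematicalPhysics.QuantumFieldTheory.Balaban1983to89.B9Eq3101ExpPointwiseMultiplier

/-!
# `Balaban1983to89.B9Eq3126QG1QInvPointDecay` — T. Bałaban, *Propagators for lattice gauge theories in a background field*, Commun. Math. Phys. **99** (1985)
# 389–434 [Balaban1985BackgroundPropagators] (3.49) p. 399, (3.126) p. 420, Lemma 3.10 p. 419, Thm 3.11 p. 416 with [Balaban1985Variational] (45) p. 285, (110)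
# p. 294: **THE EXPONENTIAL POINT DECAY OF THE KERNEL OF `(QG₁(U)Q*)⁻¹` ON THE UNIT LATTICE OF COARSE BONDS, BY COMBES–THOMAS** — the END of road ΔA-CT's
# fourth primitive row at one step: the abstract coarse-bond read-out `B9Eq349BondPointDecayFromCircle.norm_bondPoint_le_exp_of_uniform_circle_bound` (an
# operator `c` on `L²(coarse bonds)`, the point family `r_y` = the `d` bonds issuing from the coarse site `y`, a conjugation bound `‖e^{κM′}ce^{−κM′}‖ ≤ C` uniform
# over the pair weights and the circle `‖κ‖ = ρ` ⟹ `‖r_{y₁}cr_{y₀}‖ ≤ C·e^{ρ}·e^{−ρ·d_m(y₀,y₁)}`) INSTANTIATED — `norm_bondPoint_Kinv_le` — at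
# `c = (QG₁(U)Q*)⁻¹ = B11Eq103H1Complex.KinvLatticeK` with the circle letter SUPPLIED by
# `B9Eq3126ConjugatedQG1QInv.norm_conjKinv_le` (`C = 2∕μ₁`) at the operator exponentials of the pointwise multipliers — the `γ`-coercivity of `Δ_a` and the
# lower bound `μ₁` of `QG₁Q†` (Thm 3.11 ∕ [B11] (45)), the `Δ′` letters, `‖Q‖ ≤ C_Q`, the conjugated `Q(U)` ∕ `Δ′` ∕ `R(U)` letters (uniformly over the weights
# and the circle), `C_P` and the windows `small`, `small2` DISPLAYED

statement-level skeleton of published theorems with citation tags; proofs where landed; nothing here is a claim about the Yang–Mills mass gap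

CITATION HEADER (lean-in-tree rule).  Audit cell `pub-balaban`, sub-cell `t4`, BINDER row NE9 (road ΔA-CT of the NE9 formalisation swarm, leaf prover 03
`b2b-balaban-t4-ne9-formalise-leaf-03` gen 75).  Sources READ first-hand: [Balaban1985BackgroundPropagators] p. 399 (3.49) («|(QG₁Q*)⁻¹(y, y′)| ≤ O(1)e^{−δ₀|y−y′|}»
is PRINT's claim with print's `δ₀` — NOT asserted: the rate here is the radius `r` the displayed windows allow), p. 419 Lemma 3.10 (print's random-walk route,
NOT followed), p. 416 Thm 3.11, p. 420 (3.126); [Balaban1985Variational] p. 285 (45), p. 294 (110).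

WHAT IS PROVED (sorry-free; proof lane — no `def`; [folklore] Combes–Thomas ∕ Agmon read-out + composition BY NAME).
* **`norm_bondPoint_Kinv_le`** — on the one-step torus at the diagonal `ηL = 1`: `‖r_{y₁} ∘ (QG₁(U)Q*)⁻¹ ∘ r_{y₀}‖ ≤ (2∕μ₁)·e^{r}·e^{−r·d_m(y₀,y₁)}` for every
  background of the letters, every `Q : L²(fine bonds) → L²(coarse bonds)` onto, in the radius windows, given the displayed letters uniformly over the site
  weights `χ` (bond increments `≤ ℓη`), their coarse companions `χ′` (`|χ′(y) − χ(x)| ≤ ℓ′` on blocks) and the circle `‖κ‖ = r`.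
HONEST SCOPE.  Composition; displayed: `γ`, `μ₁`, `p_K`, `β_K`, `C_Q`, the conjugated `Q(U)` letters (no supplier in the tree), `ρ` and `C_P` (suppliers
`B9Eq349ConjugatedProjectionDifferenceChain`, `B9Eq325ProjectionDivergenceQuarterKappa`), the windows; the rate `r` = whatever the windows allow, NOT print's
`δ₀`; the refuter desk prices such files CELL-ONLY (letters, `∃` nowhere before `∀ U`) and so do I; NOT NE9 (cell pub-balaban: NE9 NOT PRINTED ∕ NOT PROVED;
«NE9 ⇐ the named binders»; row WALLED ON A MODEL (O-NE9-1; #5 UNRULED); spine PROVED 0∕9; rung (B)+1 on a finite T⁴ — NOT infinite volume, NOT mass gap, NOT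
BetaPertH, NOT Clay; HONEST DEPENDENCY: continuum YM on T⁴ ⇐ BetaPertH ∧ nine spine estimates (0/9 proved); BetaPertH ⇐ (D1) ∧ (D4) ∧ CAP+tail).  NEW file;
nothing modified.  Net new unproved facts: 0.
-/

noncomputable section

open scoped InnerProductSpace ComplexConjugate
open NormedSpace

namespace Literature.MathematicalPhysics.QuantumFieldTheory.Balaban1983to89.B9Eq3126QG1QInvPointDecay

open B4Sect5Torus (TSite tdist)
open B9SectCLatticeCarrier (Bond bpos btgt)
open B9Eq311L2Pairing (WL2)
open B9Eq319QprimeTorus (fineP blockCoord centre blockCoord_centre)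
open B7Prop1Explicit (U1)
open B11Eq103H1Complex (SiteL2K BondL2K covDivL2K KinvLatticeK)
open B9Eq310HessianOperator (adTransportW PlaqL2K curvOp)
open B9Eq326OperatorAssembly (laplaceAofU RofU G1ofU)
open B9Eq326ConjugatedDeltaA (apply_inv_apply' apply_apply_inv')
open B9Eq3126ConjugatedQG1QInv (norm_conjKinv_le)
open B9Eq3101ExpPointwiseMultiplier (equiv_exp_smul_apply_complex equiv_exp_smul_neg_apply_complex)
open B9Eq387IMSLocalLettersLattice (exists_pointwise_clm)
open B9Eq349BondPointDecayFromCircle (norm_bondPoint_le_exp_of_uniform_circle_bound)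

/-! ## The instance: point decay of `(QG₁(U)Q*)⁻¹` on the coarse bonds of the one-step torus -/

section Instance

variable {d : ℕ} {L : ℕ} [NeZero L] {m : Fin d → ℕ} {𝔸 : Type*} [NormedRing 𝔸] [StarRing 𝔸] [NormedAlgebra ℂ 𝔸] [StarModule ℂ 𝔸] [NormOneClass 𝔸]
  {W : Type*} [NormedAddCommGroup W] [InnerProductSpace ℂ W] [FiniteDimensional ℂ W] (φ : W ≃ₗ[ℂ] 𝔸) {Mφ Mφ' : ℝ}
  (hφ : ∀ w, ‖φ w‖ ≤ Mφ * ‖w‖) (hφ' : ∀ X, ‖φ.symm X‖ ≤ Mφ' * ‖X‖) (hMφ : 0 ≤ Mφ) (hMφ' : 0 ≤ Mφ')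
  {c₀ c₁ : ℝ} [Fact (0 < c₀)] [Fact (0 < c₁)] {η : ℝ} (hη : 0 < η) (hηL : η * L = 1) (U : Bond d (fineP L m) → 𝔸ˣ) (hU : ∀ b, U b ∈ U1 𝔸)
  (hRS : ∀ (b : Bond d (fineP L m)) (v u : W), ⟪adTransportW φ U b v, u⟫_ℂ = ⟪v, adTransportW φ (fun b => (U b)⁻¹) b u⟫_ℂ)
  (τ : 𝔸 →ₗ[ℂ] ℂ) (Q : BondL2K ℂ d (fineP L m) c₀ W →ₗ[ℂ] BondL2K ℂ d m c₁ W) (a : ℝ)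

include hφ hφ' hMφ hMφ' hη hηL hU hRS in
/-- **THE POINT DECAY OF `(QG₁(U)Q*)⁻¹` ON THE COARSE BONDS**: on the one-step torus at the diagonal `ηL = 1`, for `Δ_a(U) = Δ(U) + D_UR(U)D*_U + Q†(a•Q)` of
every background with `U(b) ∈ U1` and mutually adjoint transports and every `Q : L²(fine bonds) → L²(coarse bonds)` onto, given the `γ`-coercivity of `Δ_a`
(Thm 3.11), the lower bound `μ₁‖g‖² ≤ re⟪g, QG₁Q†g⟫` ([B11] (45)), the `Δ′` floor `p_K`, `‖Qf‖ ≤ C_Q‖f‖`, the complementary-projection letter `C_P`, the radius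
windows (`1 ≤ ℓ`, `1 ≤ ℓ′`, `rℓη ≤ 1`, `4rℓM_φM_φ′d√d ≤ β`, `4rℓM_φM_φ′d ≤ β`, `2rℓM_φM_φ′√d ≤ β`, `ρ ≤ 1∕8`, `small`, `small2`) and the conjugated `Q(U)` ∕ `Δ′` ∕
`R(U)` letters UNIFORMLY over the fine site weights `χ` (bond increments `≤ ℓη`), their coarse companions `χ′` (`|χ′(y) − χ(x)| ≤ ℓ′` on the block of `y`) and
the circle `‖κ‖ = r` (displayed): for the coarse-bond point family and every pair of coarse sites
`‖r_{y₁} ∘ (QG₁(U)Q*)⁻¹ ∘ r_{y₀}‖ ≤ (2∕μ₁)·e^{r}·e^{−r·d_m(y₀,y₁)}`.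
[cite: Balaban1985BackgroundPropagators, (3.49) p.399, (3.126) p.420, Thm 3.11 p.416; Balaban1985Variational, (45) p.285, (110) p.294] -/
theorem norm_bondPoint_Kinv_le (ha : 0 ≤ a) (hm : ∀ i, 1 ≤ m i) (hL : 1 ≤ L)
    (hpos : ∀ x : BondL2K ℂ d (fineP L m) c₀ W, x ≠ 0 → 0 < RCLike.re ⟪x, laplaceAofU L m φ η U τ Q a x⟫_ℂ) (hQs : Function.Surjective Q)
    {γ β βK pK ℓ ℓ' r ρ CP CQ μ₁ : ℝ} (hγ : 0 < γ) (hγ1 : γ ≤ 1) (hβ : 0 ≤ β) (hβ1 : β ≤ 1) (hβK : 0 ≤ βK) (hℓ : 1 ≤ ℓ) (hℓ' : 1 ≤ ℓ') (hr : 0 ≤ r)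
    (hρ : 0 ≤ ρ) (hρ8 : ρ ≤ 1 / 8) (hCP : 0 ≤ CP) (hCQ : 0 ≤ CQ) (hμ₁ : 0 < μ₁)
    (hcoer : ∀ f : BondL2K ℂ d (fineP L m) c₀ W, γ * ‖f‖ ^ 2 ≤ RCLike.re ⟪f, laplaceAofU L m φ η U τ Q a f⟫_ℂ)
    (hX1 : ∀ g : BondL2K ℂ d m c₁ W, μ₁ * ‖g‖ ^ 2 ≤ RCLike.re ⟪g, Q (G1ofU L m φ η U τ hpos (LinearMap.adjoint Q g))⟫_ℂ)
    (hKre : ∀ f : BondL2K ℂ d (fineP L m) c₀ W, -(pK * ‖f‖ ^ 2) ≤ RCLike.re ⟪f, curvOp φ τ η U f⟫_ℂ)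
    (hQ : ∀ f, ‖Q f‖ ≤ CQ * ‖f‖)
    (hwin : r * ℓ * η ≤ 1)
    (hβCC : 4 * r * ℓ * (Mφ * Mφ') * (d * Real.sqrt d) ≤ β) (hβC : 4 * r * ℓ * (Mφ * Mφ') * d ≤ β)
    (hβD : 2 * r * ℓ * (Mφ * Mφ') * Real.sqrt d ≤ β)
    (hQK : ∀ (χ : TSite d (fineP L m) → ℝ) (χ' : TSite d m → ℝ),
      (∀ b : Bond d (fineP L m), |χ (bpos b) - χ (btgt b)| ≤ ℓ * η) →
      (∀ (y : TSite d m), ∀ x ∈ B9Eq319QprimeTorus.blockOf L m y, |χ' y - χ x| ≤ ℓ') →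
      ∀ (MB : BondL2K ℂ d (fineP L m) c₀ W →L[ℂ] BondL2K ℂ d (fineP L m) c₀ W),
      (∀ (g : BondL2K ℂ d (fineP L m) c₀ W) (b : Bond d (fineP L m)),
        WL2.equiv ℂ (fun _ : Bond d (fineP L m) => c₀) W (MB g) b = (χ (bpos b) : ℂ) • WL2.equiv ℂ (fun _ : Bond d (fineP L m) => c₀) W g b) →
      ∀ (MS : SiteL2K ℂ d (fineP L m) c₀ W →L[ℂ] SiteL2K ℂ d (fineP L m) c₀ W),
      (∀ (g : SiteL2K ℂ d (fineP L m) c₀ W) (x : TSite d (fineP L m)),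
        WL2.equiv ℂ (fun _ : TSite d (fineP L m) => c₀) W (MS g) x = (χ x : ℂ) • WL2.equiv ℂ (fun _ : TSite d (fineP L m) => c₀) W g x) →
      ∀ (MF : BondL2K ℂ d m c₁ W →L[ℂ] BondL2K ℂ d m c₁ W),
      (∀ (g : BondL2K ℂ d m c₁ W) (b' : Bond d m),
        WL2.equiv ℂ (fun _ : Bond d m => c₁) W (MF g) b' = (χ' (bpos b') : ℂ) • WL2.equiv ℂ (fun _ : Bond d m => c₁) W g b') →
      ∀ κ : ℂ, ‖κ‖ = r →
      (∀ f, ‖exp (κ • MF) (Q (exp (κ • (-MB)) f)) - Q f‖ ≤ β * ‖f‖) ∧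
      (∀ g, ‖exp (κ • MB) (LinearMap.adjoint Q (exp (κ • (-MF)) g)) - LinearMap.adjoint Q g‖ ≤ β * ‖g‖) ∧
      (∀ f, ‖exp (κ • MB) (curvOp φ τ η U (exp (κ • (-MB)) f)) - curvOp φ τ η U f‖ ≤ βK * ‖f‖) ∧
      (∀ s, ‖exp (κ • MS) (RofU L m φ η U (c₀ := c₀) (exp (κ • (-MS)) s)) - RofU L m φ η U (c₀ := c₀) s‖ ≤ ρ * ‖s‖))
    (hP : ∀ f, ‖covDivL2K ℂ c₀ ((η : ℂ))⁻¹ (adTransportW φ fun b => (U b)⁻¹) f -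
      RofU L m φ η U (c₀ := c₀) (covDivL2K ℂ c₀ ((η : ℂ))⁻¹ (adTransportW φ fun b => (U b)⁻¹) f)‖ ≤ CP * ‖f‖)
    (small : pK / 2 + (21 + 3 * a) * β ^ 2 + 4 * β * CP + 2 * ρ * CP ^ 2 + βK ≤ γ / 4)
    (small2 : β * (4 / γ) * (2 * CQ + 1) + CQ * (CQ + 1) *
        (β * (4 / γ * (2 * (8 / γ) + (8 / γ + 4 / γ) + 2 * ((8 / γ + 4 / γ * CP) + 4 / γ) + a * CQ * (4 / γ) + a * (CQ + 1) * (4 / γ))) +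
          ρ * ((8 / γ + 4 / γ * CP) * ((8 / γ + 4 / γ * CP) + 4 / γ)) + βK * (4 / γ) ^ 2) ≤ μ₁ / 2)
    {rF : TSite d m → BondL2K ℂ d m c₁ W →L[ℂ] BondL2K ℂ d m c₁ W}
    (hrF : ∀ (y : TSite d m) (g : BondL2K ℂ d m c₁ W) (b' : Bond d m),
      WL2.equiv ℂ (fun _ : Bond d m => c₁) W (rF y g) b' = if bpos b' = y then WL2.equiv ℂ (fun _ : Bond d m => c₁) W g b' else 0)
    (y₀ y₁ : TSite d m) :
    ‖rF y₁ ∘L LinearMap.toContinuousLinearMap (KinvLatticeK hpos hQs) ∘L rF y₀‖ ≤ 2 / μ₁ * Real.exp r * Real.exp (-(r * tdist m y₀ y₁)) := by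
  have hL0 : (0 : ℝ) < L := by exact_mod_cast (show 0 < L by omega)
  have hι : 1 / (L : ℝ) ≤ ℓ * η := by
    rw [div_le_iff₀ hL0]
    calc (1 : ℝ) = 1 * (η * L) := by rw [hηL, mul_one]
      _ ≤ ℓ * (η * L) := by gcongr
      _ = ℓ * η * L := by ring
  refine norm_bondPoint_le_exp_of_uniform_circle_bound L m hm _ hrF hr (by positivity) hι hℓ' (fun χ χ' hχ hχ' MF hMF κ hκr => ?_) y₀ y₁
  -- the fine multipliers of this weight
  obtain ⟨MB, hMB⟩ := exists_pointwise_clm (𝕜 := ℂ) (w := fun _ : Bond d (fineP L m) => c₀) (V := W) (fun b : Bond d (fineP L m) => bpos b) χ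
  obtain ⟨MP, hMP⟩ := exists_pointwise_clm (𝕜 := ℂ) (w := fun _ : B9SectCLatticeCarrier.Plaq d (fineP L m) => c₀) (V := W)
    (fun p : B9SectCLatticeCarrier.Plaq d (fineP L m) => p.1) χ
  obtain ⟨MS, hMS⟩ := exists_pointwise_clm (𝕜 := ℂ) (w := fun _ : TSite d (fineP L m) => c₀) (V := W) (fun x : TSite d (fineP L m) => x) χ
  obtain ⟨dQ, dQ', dK, dR⟩ := hQK χ χ' hχ hχ' MB hMB MS hMS MF hMF κ hκr
  refine ContinuousLinearMap.opNorm_le_bound _ (by positivity) fun v => ?_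
  -- the eight operator exponentials at this `κ`, as linear maps with their pointwise actions
  have hS : ∀ (g : BondL2K ℂ d (fineP L m) c₀ W) (b : Bond d (fineP L m)),
      WL2.equiv ℂ (fun _ : Bond d (fineP L m) => c₀) W
          (((exp (κ • MB) : BondL2K ℂ d (fineP L m) c₀ W →L[ℂ] BondL2K ℂ d (fineP L m) c₀ W) :
            BondL2K ℂ d (fineP L m) c₀ W →ₗ[ℂ] BondL2K ℂ d (fineP L m) c₀ W) g) b =
        Complex.exp (κ * (χ (bpos b) : ℂ)) • WL2.equiv ℂ (fun _ : Bond d (fineP L m) => c₀) W g b :=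
    fun g b => equiv_exp_smul_apply_complex MB (fun b => χ (bpos b)) hMB κ g b
  have hSinv : ∀ (g : BondL2K ℂ d (fineP L m) c₀ W) (b : Bond d (fineP L m)),
      WL2.equiv ℂ (fun _ : Bond d (fineP L m) => c₀) W
          (((exp (κ • (-MB)) : BondL2K ℂ d (fineP L m) c₀ W →L[ℂ] BondL2K ℂ d (fineP L m) c₀ W) :
            BondL2K ℂ d (fineP L m) c₀ W →ₗ[ℂ] BondL2K ℂ d (fineP L m) c₀ W) g) b =
        Complex.exp (-(κ * (χ (bpos b) : ℂ))) • WL2.equiv ℂ (fun _ : Bond d (fineP L m) => c₀) W g b :=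
    fun g b => equiv_exp_smul_neg_apply_complex MB (fun b => χ (bpos b)) hMB κ g b
  have hSP : ∀ (g : PlaqL2K ℂ d (fineP L m) c₀ W) (p : B9SectCLatticeCarrier.Plaq d (fineP L m)),
      WL2.equiv ℂ (fun _ : B9SectCLatticeCarrier.Plaq d (fineP L m) => c₀) W
          (((exp (κ • MP) : PlaqL2K ℂ d (fineP L m) c₀ W →L[ℂ] PlaqL2K ℂ d (fineP L m) c₀ W) :
            PlaqL2K ℂ d (fineP L m) c₀ W →ₗ[ℂ] PlaqL2K ℂ d (fineP L m) c₀ W) g) p =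
        Complex.exp (κ * (χ p.1 : ℂ)) • WL2.equiv ℂ (fun _ : B9SectCLatticeCarrier.Plaq d (fineP L m) => c₀) W g p :=
    fun g p => equiv_exp_smul_apply_complex MP (fun p : B9SectCLatticeCarrier.Plaq d (fineP L m) => χ p.1) hMP κ g p
  have hSPinv : ∀ (g : PlaqL2K ℂ d (fineP L m) c₀ W) (p : B9SectCLatticeCarrier.Plaq d (fineP L m)),
      WL2.equiv ℂ (fun _ : B9SectCLatticeCarrier.Plaq d (fineP L m) => c₀) W
          (((exp (κ • (-MP)) : PlaqL2K ℂ d (fineP L m) c₀ W →L[ℂ] PlaqL2K ℂ d (fineP L m) c₀ W) :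
            PlaqL2K ℂ d (fineP L m) c₀ W →ₗ[ℂ] PlaqL2K ℂ d (fineP L m) c₀ W) g) p =
        Complex.exp (-(κ * (χ p.1 : ℂ))) • WL2.equiv ℂ (fun _ : B9SectCLatticeCarrier.Plaq d (fineP L m) => c₀) W g p :=
    fun g p => equiv_exp_smul_neg_apply_complex MP (fun p : B9SectCLatticeCarrier.Plaq d (fineP L m) => χ p.1) hMP κ g p
  have hSS : ∀ (g : SiteL2K ℂ d (fineP L m) c₀ W) (x : TSite d (fineP L m)),
      WL2.equiv ℂ (fun _ : TSite d (fineP L m) => c₀) W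
          (((exp (κ • MS) : SiteL2K ℂ d (fineP L m) c₀ W →L[ℂ] SiteL2K ℂ d (fineP L m) c₀ W) :
            SiteL2K ℂ d (fineP L m) c₀ W →ₗ[ℂ] SiteL2K ℂ d (fineP L m) c₀ W) g) x =
        Complex.exp (κ * (χ x : ℂ)) • WL2.equiv ℂ (fun _ : TSite d (fineP L m) => c₀) W g x :=
    fun g x => equiv_exp_smul_apply_complex MS χ hMS κ g x
  have hSSinv : ∀ (g : SiteL2K ℂ d (fineP L m) c₀ W) (x : TSite d (fineP L m)),
      WL2.equiv ℂ (fun _ : TSite d (fineP L m) => c₀) W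
          (((exp (κ • (-MS)) : SiteL2K ℂ d (fineP L m) c₀ W →L[ℂ] SiteL2K ℂ d (fineP L m) c₀ W) :
            SiteL2K ℂ d (fineP L m) c₀ W →ₗ[ℂ] SiteL2K ℂ d (fineP L m) c₀ W) g) x =
        Complex.exp (-(κ * (χ x : ℂ))) • WL2.equiv ℂ (fun _ : TSite d (fineP L m) => c₀) W g x :=
    fun g x => equiv_exp_smul_neg_apply_complex MS χ hMS κ g x
  have hSF : ∀ (g : BondL2K ℂ d m c₁ W) (b' : Bond d m),
      WL2.equiv ℂ (fun _ : Bond d m => c₁) W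
          (((exp (κ • MF) : BondL2K ℂ d m c₁ W →L[ℂ] BondL2K ℂ d m c₁ W) : BondL2K ℂ d m c₁ W →ₗ[ℂ] BondL2K ℂ d m c₁ W) g) b' =
        Complex.exp (κ * (χ' (bpos b') : ℂ)) • WL2.equiv ℂ (fun _ : Bond d m => c₁) W g b' :=
    fun g b' => equiv_exp_smul_apply_complex MF (fun b' => χ' (bpos b')) hMF κ g b'
  have hSFinv : ∀ (g : BondL2K ℂ d m c₁ W) (b' : Bond d m),
      WL2.equiv ℂ (fun _ : Bond d m => c₁) W
          (((exp (κ • (-MF)) : BondL2K ℂ d m c₁ W →L[ℂ] BondL2K ℂ d m c₁ W) : BondL2K ℂ d m c₁ W →ₗ[ℂ] BondL2K ℂ d m c₁ W) g) b' =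
        Complex.exp (-(κ * (χ' (bpos b') : ℂ))) • WL2.equiv ℂ (fun _ : Bond d m => c₁) W g b' :=
    fun g b' => equiv_exp_smul_neg_apply_complex MF (fun b' => χ' (bpos b')) hMF κ g b'
  have hSFi := apply_inv_apply' κ (fun b' : Bond d m => χ' (bpos b')) hSF hSFinv
  have hSFs := apply_apply_inv' κ (fun b' : Bond d m => χ' (bpos b')) hSF hSFinv
  -- the windows at this `κ`
  have hwinκ : ‖κ‖ * ℓ * η ≤ 1 := by rw [hκr]; exact hwin
  have hβCC' : 4 * ‖κ‖ * ℓ * (Mφ * Mφ') * (d * Real.sqrt d) ≤ β := by rw [hκr]; exact hβCC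
  have hβC' : 4 * ‖κ‖ * ℓ * (Mφ * Mφ') * d ≤ β := by rw [hκr]; exact hβC
  have hβD' : 2 * ‖κ‖ * ℓ * (Mφ * Mφ') * Real.sqrt d ≤ β := by rw [hκr]; exact hβD
  have h := norm_conjKinv_le L m φ hφ hφ' hMφ hMφ' hη U hU hRS τ Q a
    (S := ((exp (κ • MB) : BondL2K ℂ d (fineP L m) c₀ W →L[ℂ] BondL2K ℂ d (fineP L m) c₀ W) :
      BondL2K ℂ d (fineP L m) c₀ W →ₗ[ℂ] BondL2K ℂ d (fineP L m) c₀ W))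
    (Sinv := ((exp (κ • (-MB)) : BondL2K ℂ d (fineP L m) c₀ W →L[ℂ] BondL2K ℂ d (fineP L m) c₀ W) :
      BondL2K ℂ d (fineP L m) c₀ W →ₗ[ℂ] BondL2K ℂ d (fineP L m) c₀ W))
    hS hSinv hSP hSPinv hSS hSSinv hSFi hSFs ha hpos hQs hγ hγ1 hβ hβ1 hβK (zero_le_one.trans hℓ) hρ hρ8 hCP hCQ hμ₁ hcoer hX1 hKre hQ hχ hwinκ
    hβCC' hβC' hβD'
    (fun f => by simpa only [LinearMap.comp_apply, ContinuousLinearMap.coe_coe] using dQ f)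
    (fun g => by simpa only [LinearMap.comp_apply, ContinuousLinearMap.coe_coe] using dQ' g)
    (fun f => by simpa only [LinearMap.comp_apply, ContinuousLinearMap.coe_coe] using dK f)
    (fun s => by simpa only [LinearMap.comp_apply, ContinuousLinearMap.coe_coe] using dR s) hP small small2 v
  simpa only [ContinuousLinearMap.comp_apply, LinearMap.coe_toContinuousLinearMap', LinearMap.comp_apply, ContinuousLinearMap.coe_coe] using h

end Instance

end Literature.MathematicalPhysics.QuantumFieldTheory.Balaban1983to89.B9Eq3126QG1QInvPointDecay

end
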